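import Summits.Ventures.PercRepro.Night2FatDDComb

/-!
# night-2: the doubly degenerate regime — the complement bound of one line condition, and the singletons

For a line with closure `C`, `n` basis points on it and the class property `cls`, the line condition of the unloaded
family (`dload_eq_zero_of_dd_family`) is `(n ≥ 2 → cls → |Y ∖ C| ≥ 2) ∧ (n ≥ 2 → ¬ cls → Y ⊄ C) ∧ (n = 1 → cls → Y ⊄ C)`;
its complement among the `k`-subsets of `W` has at most `[n ≥ 1]·C(s, k) + [n ≥ 2]·(|W| − s)·C(s, k − 1)` members
when the line is class and `[n ≥ 2]·C(s, k)` when it is not, `s = |W ∩ C|` (**`card_filter_not_line_cond_le`**).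
The points of `W` off two non-class lines with two basis points number at least `|W| − s₂ − s₃`
(**`card_filter_singletons_ge`**).  Paper `proofs/NIGHT-2-g35.md` §7.
-/

namespace PercRepro.Shadow

variable {α : Type*} [DecidableEq α]

/-- **The complement of one line condition** (see the module docstring). -/
theorem card_filter_not_line_cond_le (W C : Finset α) (k n : ℕ) (cls : Prop) [Decidable cls] :
    ((W.powersetCard k).filter (fun Y => ¬ ((2 ≤ n → cls → 2 ≤ (Y \ C).card) ∧ (2 ≤ n → ¬ cls → ¬ Y ⊆ C) ∧
      (n = 1 → cls → ¬ Y ⊆ C)))).card ≤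
      if cls then (if 1 ≤ n then (W.filter (fun e => e ∈ C)).card.choose k else 0) +
          (if 2 ≤ n then (W.card - (W.filter (fun e => e ∈ C)).card) *
            (W.filter (fun e => e ∈ C)).card.choose (k - 1) else 0)
        else (if 2 ≤ n then (W.filter (fun e => e ∈ C)).card.choose k else 0) := by
  set S := W.filter (fun e => e ∈ C) with hS
  have hSW : S ⊆ W := Finset.filter_subset _ _
  -- for `Y ⊆ W`: `Y ⊆ C ↔ Y ⊆ S` and `Y \ C = Y \ S`
  have hsub : ∀ Y ∈ W.powersetCard k, (Y ⊆ C ↔ Y ⊆ S) := by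
    intro Y hY
    have hYW : Y ⊆ W := (Finset.mem_powersetCard.1 hY).1
    constructor
    · intro h e he; exact Finset.mem_filter.2 ⟨hYW he, h he⟩
    · intro h e he; exact (Finset.mem_filter.1 (h he)).2
  have hsd : ∀ Y ∈ W.powersetCard k, Y \ C = Y \ S := by
    intro Y hY
    have hYW : Y ⊆ W := (Finset.mem_powersetCard.1 hY).1
    ext e
    rw [Finset.mem_sdiff, Finset.mem_sdiff, hS, Finset.mem_filter]
    constructor
    · rintro ⟨he, heC⟩; exact ⟨he, fun h => heC h.2⟩
    · rintro ⟨he, heS⟩; exact ⟨he, fun h => heS ⟨hYW he, h⟩⟩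
  by_cases hcls : cls
  · rw [if_pos hcls]
    rcases Nat.lt_or_ge n 1 with h0 | h1
    · -- no basis point: the condition is trivial
      rw [if_neg (by omega), if_neg (by omega)]
      have : (W.powersetCard k).filter (fun Y => ¬ ((2 ≤ n → cls → 2 ≤ (Y \ C).card) ∧ (2 ≤ n → ¬ cls → ¬ Y ⊆ C) ∧
          (n = 1 → cls → ¬ Y ⊆ C))) = ∅ := by
        rw [Finset.filter_eq_empty_iff]
        intro Y _ h
        exact h ⟨fun h2 => absurd h2 (by omega), fun h2 => absurd h2 (by omega), fun h1 => absurd h1 (by omega)⟩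
      rw [this, Finset.card_empty]
    rcases Nat.lt_or_ge n 2 with h1' | h2
    · -- one basis point: the complement is `Y ⊆ C`
      rw [if_pos h1, if_neg (by omega), Nat.add_zero]
      have hn1 : n = 1 := by omega
      refine le_of_le_of_eq (Finset.card_le_card ?_) (card_filter_subset_powersetCard W S hSW k)
      intro Y hY
      rw [Finset.mem_filter] at hY ⊢
      refine ⟨hY.1, ?_⟩
      by_contra hYS
      exact hY.2 ⟨fun h2 => absurd h2 (by omega), fun h2 => absurd h2 (by omega),
        fun _ _ => fun h => hYS ((hsub Y hY.1).1 h)⟩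
    · -- two basis points: the complement is `|Y ∖ C| ≤ 1`
      rw [if_pos h1, if_pos h2]
      refine le_trans (Finset.card_le_card ?_) (card_filter_sdiff_le_one_le W S hSW k)
      intro Y hY
      rw [Finset.mem_filter] at hY ⊢
      refine ⟨hY.1, ?_⟩
      rw [← hsd Y hY.1]
      by_contra hY1
      exact hY.2 ⟨fun _ _ => by omega, fun _ h => absurd hcls h, fun h1 => absurd h1 (by omega)⟩
  · rw [if_neg hcls]
    rcases Nat.lt_or_ge n 2 with h1 | h2
    · rw [if_neg (by omega)]
      have : (W.powersetCard k).filter (fun Y => ¬ ((2 ≤ n → cls → 2 ≤ (Y \ C).card) ∧ (2 ≤ n → ¬ cls → ¬ Y ⊆ C) ∧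
          (n = 1 → cls → ¬ Y ⊆ C))) = ∅ := by
        rw [Finset.filter_eq_empty_iff]
        intro Y _ h
        exact h ⟨fun h2 => absurd h2 (by omega), fun h2 => absurd h2 (by omega), fun _ hc => absurd hc hcls⟩
      rw [this, Finset.card_empty]
    · rw [if_pos h2]
      refine le_of_le_of_eq (Finset.card_le_card ?_) (card_filter_subset_powersetCard W S hSW k)
      intro Y hY
      rw [Finset.mem_filter] at hY ⊢
      refine ⟨hY.1, ?_⟩
      by_contra hYS
      exact hY.2 ⟨fun _ hc => absurd hc hcls, fun _ _ => fun h => hYS ((hsub Y hY.1).1 h), fun _ hc => absurd hc hcls⟩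

/-- **The unloaded singletons**: the points of `W` off the traces of two lines number at least `|W| − s₂ − s₃`;
a line contributes only when it is "active" (`a₂` / `a₃`), otherwise its trace is ignored. -/
theorem card_filter_singletons_ge (W C₂ C₃ : Finset α) (a₂ a₃ : Prop) [Decidable a₂] [Decidable a₃] :
    W.card - (if a₂ then (W.filter (fun e => e ∈ C₂)).card else 0) -
        (if a₃ then (W.filter (fun e => e ∈ C₃)).card else 0) ≤
      (W.filter (fun y => (a₂ → y ∉ C₂) ∧ (a₃ → y ∉ C₃))).card := by
  set E := W.filter (fun y => (a₂ → y ∉ C₂) ∧ (a₃ → y ∉ C₃)) with hE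
  set S₂ := (if a₂ then W.filter (fun e => e ∈ C₂) else ∅) with hS₂
  set S₃ := (if a₃ then W.filter (fun e => e ∈ C₃) else ∅) with hS₃
  have hcover : W ⊆ E ∪ (S₂ ∪ S₃) := by
    intro y hy
    rw [Finset.mem_union, Finset.mem_union]
    by_cases h2 : a₂ ∧ y ∈ C₂
    · right; left; rw [hS₂, if_pos h2.1]; exact Finset.mem_filter.2 ⟨hy, h2.2⟩
    by_cases h3 : a₃ ∧ y ∈ C₃
    · right; right; rw [hS₃, if_pos h3.1]; exact Finset.mem_filter.2 ⟨hy, h3.2⟩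
    · left
      rw [hE, Finset.mem_filter]
      exact ⟨hy, fun ha hyC => h2 ⟨ha, hyC⟩, fun ha hyC => h3 ⟨ha, hyC⟩⟩
  have h1 := Finset.card_le_card hcover
  have h2 := Finset.card_union_le E (S₂ ∪ S₃)
  have h3 := Finset.card_union_le S₂ S₃
  have hS₂c : S₂.card = if a₂ then (W.filter (fun e => e ∈ C₂)).card else 0 := by
    rw [hS₂]; split_ifs <;> simp
  have hS₃c : S₃.card = if a₃ then (W.filter (fun e => e ∈ C₃)).card else 0 := by
    rw [hS₃]; split_ifs <;> simp
  omega

end PercRepro.Shadow
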